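import Mathlib
import HarnessLib
import Literature.Probability.MarkovChains.IsingHeatBathMonotone
import Literature.Probability.MarkovChains.DistinguishingStatistic

/-!
# The ferromagnetic Ising heat-bath (Glauber) dynamics is a monotone spin system (Levin–Peres–Wilmer Examples 22.2, 22.9)

HONEST FRAMING: exact (Metropolis-corrected) sampling algorithms for lattice gauge theory; figures
of merit are autocorrelation/cost numbers at stated couplings and volumes; no continuum-physics claim.

Conventions of `GlauberDynamics.lean` (`AgreeOff`, `glauberSiteLaw π σ v` = the single-site update
kernel `P_v(σ, ·)`, `glauberKernel π` = the uniform-site Glauber dynamics), `IsingGlauber.lean`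
(`gibbsLaw G β`, eq. (3.11)), `IsingHeatBathMonotone.lean` (`SpinLE`, `isingPlusProb G β σ x = p(σ,x)`,
its monotonicity in `σ` for `β ≥ 0`) and `DistinguishingStatistic.lean` (`lawMean`).  Configurations
`σ : V → ℤˣ` carry the coordinate-wise order (`−1 < +1`), which is `SpinLE` (`spinLE_iff_le`).
"Monotone chain" is spelled out as in the book — `f` increasing ⟹ `P f` increasing — i.e. the
predicate `IsMonotoneChain` of `StochasticDomination.lean` unfolded, so the results below instantiate
it by `rfl`.  Source: D. A. Levin, Y. Peres (with E. L. Wilmer), *Markov Chains and Mixing Times*,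
2nd ed., AMS 2017 [LevinPeres2017], §22.1 Example 22.2 (eq. (22.1), p. 306), §22.3 (definition of a
monotone chain) and §22.3.1 Example 22.9 (p. 309); read from the author-hosted copy.  Everything is
PROVED (0 named facts).

* `spinLE_iff_le` — the book's coordinate-wise order on `{−1,+1}^V` is the order of `IsingHeatBathMonotone`
  [cite: LevinPeres2017, §22.1 Example 22.2 ("If the initial state `σ` dominates the initial state
  `θ`")];
* `AgreeOff.le_or_ge` — two configurations of a chain-valued spin system differing at one site only are
  comparable [cite: LevinPeres2017, §22.4 Thm 22.16 (hypothesis "`x` and `y` are comparable whenever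
  `P(x,y) > 0`", which it verifies for single-site dynamics: "satisfied in monotone spin systems")];
* `lawMean_isingSiteLaw` — `(P_v f)(σ) = p(σ,v) f(σ^{v,+}) + (1 − p(σ,v)) f(σ^{v,−})`
  [cite: LevinPeres2017, §3.3.5 eq. (3.11) with §22.1 eq. (22.1)];
* **EXAMPLE 22.9 / 22.2** `LevinPeres2017_example_22_9` — for `β ≥ 0` every single-site heat-bath
  kernel `P_v` of the Ising model is a MONOTONE chain ("the Glauber chain is a monotone spin system")
  [cite: LevinPeres2017, §22.3.1 Example 22.9]; `isingGlauber_monotone` — so is the uniform-site Glauber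
  dynamics `|V|⁻¹ Σ_v P_v` [cite: LevinPeres2017, §22.1 Example 22.2 ("Since `p(θ,v)` is non-decreasing
  in `θ`, the coupling is monotone")];
* `isingSiteLaw_pos_le_or_ge`, `isingGlauber_pos_le_or_ge` — the Ising dynamics moves only between
  comparable configurations (the standing hypothesis of Theorem 22.16)
  [cite: LevinPeres2017, §22.4 Thm 22.16 ("The hypothesis … is satisfied in monotone spin systems")].

Context (cell pub-lqcd, venture LatticeQCDFlow): the concrete case on which the Chapter-22
toolbox (Proposition 22.7 couplings, Theorem 22.16 positive correlations, Theorem 22.20 censoring of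
heat-bath sweeps) acts — the single-site heat-bath sampler of a ferromagnetic lattice model.
-/

namespace Literature.Probability.MarkovChains

open Finset Function

/-! ## The coordinate-wise order on `{−1,+1}^V` and single-site classes -/

section Order

variable {V : Type*}

/-- `SpinLE σ η` (coordinate-wise `σ(v) ≤ η(v)` in `ℤ`) is the product order on `V → ℤˣ`.
[cite: LevinPeres2017, §22.1 Example 22.2 (domination of configurations)] -/
theorem spinLE_iff_le (σ η : V → ℤˣ) : SpinLE σ η ↔ σ ≤ η := by
  simp only [SpinLE, Pi.le_def, ← Units.val_le_val]

/-- Two configurations of a system of totally ordered spins which agree off one site are comparable.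
[cite: LevinPeres2017, §22.4 Thm 22.16 (its comparability hypothesis holds "in monotone spin
systems")] -/
theorem AgreeOff.le_or_ge {S : Type*} [LinearOrder S] [DecidableEq V] {σ y : V → S} {v : V}
    (h : AgreeOff σ v y) : σ ≤ y ∨ y ≤ σ := by
  rcases le_total (σ v) (y v) with hv | hv
  · refine Or.inl fun w => ?_
    by_cases hw : w = v
    · subst hw; exact hv
    · exact (h w hw).symm.le
  · refine Or.inr fun w => ?_
    by_cases hw : w = v
    · subst hw; exact hv
    · exact (h w hw).le

/-- Single-site modification is increasing in the configuration: `σ ≤ τ ⟹ σ^{v←s} ≤ τ^{v←s}`.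
[folklore] -/
private theorem update_le_update_of_le {S : Type*} [Preorder S] [DecidableEq V] {σ τ : V → S}
    (h : σ ≤ τ) (v : V) (s : S) : update σ v s ≤ update τ v s := by
  intro w
  by_cases hw : w = v
  · subst hw; simp
  · simp only [update_of_ne hw]; exact h w

end Order

/-! ## The Ising single-site kernel as a two-point average -/

section Ising

variable {V : Type*} [Fintype V] [DecidableEq V] {G : SimpleGraph V} [DecidableRel G.Adj]

omit [DecidableRel G.Adj] in
/-- `E_{P_v(σ,·)} f = Σ_s P_v(σ, σ^{v←s}) f(σ^{v←s})` — the update law lives on the single-site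
modifications of `σ`. [cite: LevinPeres2017, §3.3.2 eqs. (3.6)–(3.7)] -/
theorem lawMean_glauberSiteLaw_eq_sum_update {S : Type*} [Fintype S] [DecidableEq S]
    (π : (V → S) → ℝ) (σ : V → S) (v : V) (f : (V → S) → ℝ) :
    lawMean (fun y => glauberSiteLaw π σ v y) f
      = ∑ s : S, glauberSiteLaw π σ v (update σ v s) * f (update σ v s) := by
  simp only [lawMean]
  -- the summand vanishes off `σ•_v`, which is the image of `update σ v`
  rw [← sum_filter_add_sum_filter_not univ (AgreeOff σ v)]
  have h0 : ∑ y ∈ univ.filter (fun y => ¬AgreeOff σ v y), glauberSiteLaw π σ v y * f y = 0 :=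
    sum_eq_zero fun y hy => by
      rw [glauberSiteLaw, if_neg (mem_filter.mp hy).2, zero_mul]
  rw [h0, add_zero]
  have hset : univ.filter (AgreeOff σ v) = univ.image (update σ v) := by
    ext y
    simp only [mem_filter, mem_univ, true_and, mem_image]
    exact ⟨fun h => ⟨y v, h.eq_update.symm⟩, fun ⟨s, hs⟩ => hs ▸ agreeOff_update σ v s⟩
  rw [hset, sum_image fun s _ s' _ h => update_injective σ v h]

/-- The minus-update probability is `1 − p(σ,v)`. [cite: LevinPeres2017, §22.1 eq. (22.1) and
Example 22.2 ("and to be `−1` otherwise")] -/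
theorem isingSiteLaw_update_neg_one (β : ℝ) (σ : V → ℤˣ) (v : V) :
    glauberSiteLaw (gibbsLaw G β) σ v (update σ v (-1)) = 1 - isingPlusProb G β σ v := by
  have h1 : ∑ y, glauberSiteLaw (gibbsLaw G β) σ v y = 1 :=
    sum_glauberSiteLaw (siteMass_pos (gibbsLaw_pos β) σ v).ne'
  have h2 := lawMean_glauberSiteLaw_eq_sum_update (gibbsLaw G β) σ v (fun _ => (1 : ℝ))
  simp only [lawMean, mul_one] at h2
  rw [h1, sum_units_int, ← isingPlusProb_eq_glauberSiteLaw] at h2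
  linarith

/-- **`(P_v f)(σ) = p(σ,v) f(σ^{v,+}) + (1 − p(σ,v)) f(σ^{v,−})`.**
[cite: LevinPeres2017, §3.3.5 eq. (3.11) with §22.1 eq. (22.1)] -/
theorem lawMean_isingSiteLaw (β : ℝ) (σ : V → ℤˣ) (v : V) (f : (V → ℤˣ) → ℝ) :
    lawMean (fun y => glauberSiteLaw (gibbsLaw G β) σ v y) f
      = isingPlusProb G β σ v * f (update σ v 1) + (1 - isingPlusProb G β σ v) * f (update σ v (-1)) := by
  rw [lawMean_glauberSiteLaw_eq_sum_update, sum_units_int, ← isingPlusProb_eq_glauberSiteLaw,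
    isingSiteLaw_update_neg_one]

/-! ## Example 22.9: the heat-bath kernels are monotone -/

/-- **EXAMPLE 22.9 (the Ising model is a monotone spin system).**  For `β ≥ 0` and every site `v`,
the single-site heat-bath kernel `P_v` is a monotone chain: `f` increasing ⟹ `P_v f` increasing.
Proof: for `σ ≤ τ`, `(P_vf)(σ) = (1−p(σ))f(σ⁻) + p(σ)f(σ⁺) ≤ (1−p(σ))f(τ⁻) + p(σ)f(τ⁺) ≤
(1−p(τ))f(τ⁻) + p(τ)f(τ⁺)`, using `σ^± ≤ τ^±`, `f(τ⁻) ≤ f(τ⁺)` and `p(σ,v) ≤ p(τ,v)`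
(eq. (22.1): `p` is non-decreasing in the configuration). [cite: LevinPeres2017, §22.3.1 Example 22.9
with §22.1 Example 22.2 / eq. (22.1)] -/
theorem LevinPeres2017_example_22_9 {β : ℝ} (hβ : 0 ≤ β) (v : V) (f : (V → ℤˣ) → ℝ)
    (hf : Monotone f) :
    Monotone (fun σ => lawMean (fun y => glauberSiteLaw (gibbsLaw G β) σ v y) f) := by
  intro σ τ hστ
  simp only [lawMean_isingSiteLaw]
  have hm : f (update σ v (-1)) ≤ f (update τ v (-1)) := hf (update_le_update_of_le hστ v _)
  have hp : f (update σ v 1) ≤ f (update τ v 1) := hf (update_le_update_of_le hστ v _)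
  have hτ : f (update τ v (-1)) ≤ f (update τ v 1) :=
    hf (fun w => by
      by_cases hw : w = v
      · subst hw
        simp only [update_self]
        exact Units.val_le_val.mp (by norm_num)
      · simp [update_of_ne hw])
  have hpp : isingPlusProb G β σ v ≤ isingPlusProb G β τ v :=
    isingPlusProb_mono (G := G) hβ ((spinLE_iff_le σ τ).mpr hστ) v
  have h0 : 0 ≤ isingPlusProb G β σ v := (isingPlusProb_pos (G := G) β σ v).le
  have h1 : isingPlusProb G β τ v ≤ 1 := (isingPlusProb_lt_one (G := G) β τ v).le
  nlinarith [mul_le_mul_of_nonneg_left hp h0, mul_nonneg (sub_nonneg.mpr hpp) (sub_nonneg.mpr hτ)]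

/-- **EXAMPLE 22.2**: the uniform-site Glauber dynamics `|V|⁻¹ Σ_v P_v` of the ferromagnetic Ising model
is a monotone chain. [cite: LevinPeres2017, §22.1 Example 22.2 ("Since `p(θ,v)` is non-decreasing in
`θ`, the coupling is monotone")] -/
theorem isingGlauber_monotone {β : ℝ} (hβ : 0 ≤ β) (f : (V → ℤˣ) → ℝ) (hf : Monotone f) :
    Monotone (fun σ => lawMean (glauberKernel (gibbsLaw G β) σ) f) := by
  intro σ τ hστ
  have e : ∀ ρ : V → ℤˣ, lawMean (glauberKernel (gibbsLaw G β) ρ) f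
      = (Fintype.card V : ℝ)⁻¹ * ∑ v, lawMean (fun y => glauberSiteLaw (gibbsLaw G β) ρ v y) f := by
    intro ρ
    simp only [lawMean, glauberKernel_apply, mul_sum, sum_mul, mul_assoc]
    rw [sum_comm]
  simp only [e]
  exact mul_le_mul_of_nonneg_left
    (sum_le_sum fun v _ => LevinPeres2017_example_22_9 hβ v f hf hστ)
    (inv_nonneg.mpr (Nat.cast_nonneg _))

/-! ## The dynamics moves between comparable configurations -/

omit [DecidableRel G.Adj] in
/-- `P_v(σ,τ) > 0 ⟹ σ, τ comparable`. [cite: LevinPeres2017, §22.4 Thm 22.16 (its hypothesis holds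
for monotone spin systems)] -/
theorem isingSiteLaw_pos_le_or_ge {π : (V → ℤˣ) → ℝ} {σ τ : V → ℤˣ} {v : V}
    (h : 0 < glauberSiteLaw π σ v τ) : σ ≤ τ ∨ τ ≤ σ := by
  by_cases hA : AgreeOff σ v τ
  · exact hA.le_or_ge
  · rw [glauberSiteLaw, if_neg hA] at h
    exact absurd h (lt_irrefl 0)

omit [DecidableRel G.Adj] in
/-- `P(σ,τ) > 0` for the uniform-site Glauber dynamics ⟹ `σ, τ` comparable.
[cite: LevinPeres2017, §22.4 Thm 22.16 (hypothesis, monotone spin systems)] -/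
theorem isingGlauber_pos_le_or_ge {π : (V → ℤˣ) → ℝ}
    {σ τ : V → ℤˣ} (h : 0 < glauberKernel π σ τ) : σ ≤ τ ∨ τ ≤ σ := by
  rw [glauberKernel_apply] at h
  have hpos : 0 < ∑ v, glauberSiteLaw π σ v τ := by
    by_contra hS
    exact absurd h (not_lt.mpr (mul_nonpos_of_nonneg_of_nonpos
      (inv_nonneg.mpr (Nat.cast_nonneg _)) (not_lt.mp hS)))
  obtain ⟨v, -, hv⟩ := exists_lt_of_sum_lt (s := univ) (f := fun _ => (0 : ℝ))
    (g := fun v => glauberSiteLaw π σ v τ) (by simpa using hpos)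
  exact isingSiteLaw_pos_le_or_ge hv

end Ising

end Literature.Probability.MarkovChains
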